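import Literature.Barriers.CriticalPhenomena.PositionSpaceRGNonGibbsianIsraelComparison
import Literature.Barriers.CriticalPhenomena.PositionSpaceRGNonGibbsianDiluted
import HarnessLib

/-!
# Israel's example (van Enter–Fernández–Sokal 1993, §4.1.2): Step 3 — the finite-volume estimate
# (4.13) from the magnetisation of the reduced system (Step 2)

Companion file of `PositionSpaceRGNonGibbsianThm41.lean` (Theorem 4.1 ⇐ `VEFS1993_eq413_israel`).
Here `VEFS1993_eq413_israel` (the finite-volume estimate (4.3)–(4.5)/(4.13)) is PROVED from the
outcome of Step 2 for the reduced system — the named fact `VEFS1993_eq46_reduced`: a positive lower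
bound, uniform in `R` large, on the magnetisation `⟨σ_{1,0}⟩` of the reduced internal-spin system
of Figure 4(c) (`+`-boundary Ising model on `cutGraph n` in the volume `Λ^int_{2n+2}`), which the
source obtains by dedecoration and the spontaneous magnetisation `M₀(J') > 0`, `J' = ½ log cosh 2J`
(eq. (4.6)). The unfixing identity (4.7), the spin flip (4.8) and the elementary bound (4.9) are
the general lemmas `isingExpect_spinAt_eq_unfix`, `isingExpect_fixed_neg`, `unfix_gap_bound` of
the accepted `PositionSpaceRGNonGibbsianUnfixing.lean` (Theorem 4.2 line).

## What the source prints (arXiv:hep-lat/9210032, pp. 99–100) and how it is made rigorous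

Step 3: (4.7) `⟨σ_{0,0}⟩̃₊ = (1 - ⟨e^{-2JS}⟩₊)/(1 + ⟨e^{-2JS}⟩₊)`, `S = σ_{0,1}+σ_{0,-1}+σ_{1,0}+
σ_{-1,0}`, `⟨·⟩₊` the system with the origin frozen `+`; (4.8) "Similarly, for the analogous
system with the image spins in `Γ^image_{R+2}` set to `-`, we have `⟨σ_{0,0}⟩̃₋ = … =
(1 - ⟨e^{+2JS}⟩₊)/(1 + ⟨e^{+2JS}⟩₊)`" (by the global spin flip; footnote 48: "the two situations
are not quite symmetric. But the only change is a shift in the location of the internal spins in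
`Γ_{R+1}` which feel a nonzero effective field; and this is irrelevant, since we replace these
fields by zero anyway"); (4.9) "`⟨σ_{0,0}⟩̃₊ - ⟨σ_{0,0}⟩̃₋ = 2(y - x)/((1+x)(1+y))`",
`x = ⟨e^{-2JS}⟩₊`, `y = ⟨e^{+2JS}⟩₊` (4.10)–(4.11); (4.12) "`y - x = 2⟨sinh 2JS⟩₊ =
2 ∑_{k odd} (2J)^k/k! ⟨S^k⟩₊ ≥ 4J⟨S⟩₊ = 16J⟨σ_{0,1}⟩₊`, since the contributions from
`k = 3, 5, …` are all nonnegative by Griffiths' first inequality. On the other hand, the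
denominator in (4.9) is bounded between `1` and `(1+e^{8J})²`. Since we proved previously that for
`J' > J_c`, the local magnetization `⟨σ_{0,1}⟩₊` is bounded below by a strictly positive constant,
uniformly in `R` (sufficiently large) and in the configuration outside `Λ_{R+2}`, we can conclude
that `⟨σ_{0,0}⟩̃₊ - ⟨σ_{0,0}⟩̃₋ ≥ δ > 0` (4.13) uniformly in `R` (sufficiently large) and in the
configuration outside `Λ_{R+2}`."

The rigorous version proved here makes footnote 48 precise: the expectations `x` of the `+`
pattern and (after the spin flip) `y` of the `-` pattern live in DIFFERENT admissible
internal-spin systems (image spins `±ω'_alt`, arbitrary exterior), and both are compared, by the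
FKG comparison of Step 2 (`isingExpect_admissible_le_cut`, `isingExpect_cut_le_admissible`:
`e^{-2βS}` is nonincreasing, `e^{+2βS}` nondecreasing), with the SAME reduced system `Q_n`:
`x ≤ x_Q = ⟨e^{-2βS}⟩_{Q_n}`, `y ≥ y_Q = ⟨e^{+2βS}⟩_{Q_n}`. Hence `⟨σ_0⟩ ≥ c₊ = (1-x_Q)/(1+x_Q)` on
the `+` pattern and `≤ c₋ = (1-y_Q)/(1+y_Q)` on the `-` pattern, and (4.9)–(4.12) are applied in
`Q_n`: `y_Q - x_Q = ⟨∏(c + sσ) - ∏(c - sσ)⟩_{Q_n} = ∑_{A} (coefficients ≥ 0)·⟨σ_A⟩_{Q_n}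
≥ 2 sinh 2β · ⟨σ_{1,0}⟩_{Q_n}` (the finite product expansion over the neighbours of the origin in
place of the Taylor series; Griffiths I in the `+`-boundary system `Q_n`, `gks_one_holds
(cutGraph n)`), `0 < x_Q, y_Q ≤ e^{2β deg 0}`.

## What is formalised (namespace `Literature.Barriers.CriticalPhenomena.NonGibbs`)

The named fact `VEFS1993_eq46_reduced` (Step 2 for the reduced system) and the PROVED reduction
`VEFS1993_eq413_israel_of_eq46 : VEFS1993_eq46_reduced → VEFS1993_eq413_israel`, with the
intermediate results `isAdmissibleBC_of_mem_plusSelected`, `isAdmissibleBC_neg_of_mem_minusSelected`,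
the product expansion `isingExpect_unfixExpPos_sub_unfixExpNeg_ge`, and the pattern bounds
`isingExpect_spinAt_zero_ge_of_plusSelected`, `isingExpect_spinAt_zero_le_of_minusSelected`.
Combined with `VEFS1993_thm41_of_eq413_israel`: `VEFS1993_thm41_of_eq46`.
-/

noncomputable section

namespace Literature.Barriers.CriticalPhenomena.NonGibbs

open MeasureTheory Finset Literature.Probability.LatticeModels Literature.Probability.LatticeModels.AEdge

/-! ### The named fact: Step 2 for the reduced system (eq. (4.6)) -/

/-- **van Enter–Fernández–Sokal 1993, §4.1.2 Step 2, eq. (4.6), for the reduced system of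
Figure 4(c).** For every coupling `β > ½ cosh⁻¹(1+√2)` (`israelThreshold`; equivalently
`J' = ½ log cosh 2β > J_c = ½ log(1+√2)`) there are `m > 0` and `n₀` such that for all `n ≥ n₀`
the magnetisation of the internal spin `(1,0)` adjacent to the origin in the REDUCED system —
"a system consisting of the spins in `Λ^int_{R+2}`, with a magnetic field `+J` on each spin in
layer `Γ^int_{R+2}`" and no other field (`R = 2n`; the `+`-boundary nearest-neighbour Ising model
on `cutGraph n` in the volume `internalVolume n`, zero bulk field) — is at least `m`: printed as
"(4.6) `⟨σ_{i₁,i₂}⟩_{Λ^int_{R+2}} = ⟨tanh(J(σ'+σ''))⟩_{R+2} = ⟨½ tanh 2J (σ'+σ'')⟩_{R+2} →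
(tanh 2J) M₀(J') > 0` … We have therefore proven our claim that the magnetizations
`⟨σ_{i₁,i₂}⟩` for `(i₁,i₂) ∈ Λ^int_{R+1}` are bounded below by a strictly positive constant
[namely `(1-ε)(tanh 2J)M₀(J')` for any `ε > 0`], uniformly in `R`". Its printed proof:
dedecoration of the spins with two neighbours ("effective coupling `J' = ½ log cosh 2J`",
"effective magnetic field `h' = ½ log cosh 2J > 0` … `2h'` at the corners"), identification with
"a square lattice of size `(R+2) × (R+2)` with nearest-neighbor coupling `J'` and `+` boundary
conditions", whose magnetisation "tends to the spontaneous magnetization `M₀(J')`, which is `> 0`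
if `J' > J_c`" (Onsager). Named fact, not proved here.
[cite: VanenterFernandezSokal1993, §4.1.2 Step 2 eq. (4.6) and Figure 4(c)–(e)] -/
def VEFS1993_eq46_reduced : Prop :=
  ∀ β : ℝ, israelThreshold < β → ∃ m : ℝ, 0 < m ∧ ∃ n₀ : ℕ, ∀ n : ℕ, n₀ ≤ n →
    m ≤ isingExpect (cutGraph n) (internalVolume n) β 0 .plus (spinAt (vec 0))

/-! ### The neighbours of the origin -/

/-- The neighbours of the origin lie in `W'_n`. [cite: VanenterFernandezSokal1993, §4.1.2 Step 3] -/
theorem neighborFinset_zero_subset_internalVolume (n : ℕ) :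
    (zdGraph 2).neighborFinset 0 ⊆ internalVolume n := fun _ hy =>
  mem_internalVolume_of_adj_zero n ((SimpleGraph.mem_neighborFinset _ _ _).1 hy)

/-- `eᵢ` is a neighbour of the origin. [cite: VanenterFernandezSokal1993, §4.1.2 Step 3] -/
theorem vec_mem_neighborFinset_zero (i : Fin 2) : vec i ∈ (zdGraph 2).neighborFinset 0 := by
  rw [SimpleGraph.mem_neighborFinset]
  have h := AEdge.adj ((0 : Site 2), i)
  simp only [tip, zero_add] at h
  exact h

/-- The neighbours of the origin stay internal after removing the origin from `W_n` (the hypothesis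
`hN` of the unfixing identity). [cite: VanenterFernandezSokal1993, §4.1.2 Step 3] -/
theorem mem_israelVolume_erase_of_adj_zero (n : ℕ) :
    ∀ y, (zdGraph 2).Adj 0 y → y ∈ (israelVolume n).erase 0 := fun y hy => by
  rw [israelVolume_erase_zero]; exact mem_internalVolume_of_adj_zero n hy

/-! ### The two exponential observables `e^{∓2βS}` -/

/-- `x` of (4.10): the observable `e^{-2βS}`. [cite: VanenterFernandezSokal1993, §4.1.2 Step 3 eq. (4.10)] -/
def unfixExpNeg (β : ℝ) (σ : SpinConfig (Site 2)) : ℝ := Real.exp (-(2 * β * nbrSpinSum (zdGraph 2) 0 σ))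

/-- `y` of (4.11): the observable `e^{+2βS}`. [cite: VanenterFernandezSokal1993, §4.1.2 Step 3 eq. (4.11)] -/
def unfixExpPos (β : ℝ) (σ : SpinConfig (Site 2)) : ℝ := Real.exp (2 * β * nbrSpinSum (zdGraph 2) 0 σ)

/-- `e^{-2βS}` is measurable. [cite: VanenterFernandezSokal1993, §4.1.2 Step 3] -/
@[fun_prop] theorem measurable_unfixExpNeg (β : ℝ) : Measurable (unfixExpNeg β) :=
  Real.measurable_exp.comp ((measurable_nbrSpinSum (zdGraph 2) 0).const_mul _).neg

/-- `e^{+2βS}` is measurable. [cite: VanenterFernandezSokal1993, §4.1.2 Step 3] -/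
@[fun_prop] theorem measurable_unfixExpPos (β : ℝ) : Measurable (unfixExpPos β) :=
  Real.measurable_exp.comp ((measurable_nbrSpinSum (zdGraph 2) 0).const_mul _)

/-- `e^{-2βS}` is nonincreasing for `β ≥ 0`. [cite: VanenterFernandezSokal1993, §4.1.2 Step 3] -/
theorem unfixExpNeg_antitone {β : ℝ} (hβ : 0 ≤ β) : Antitone (unfixExpNeg β) := fun σ σ' h => by
  unfold unfixExpNeg
  refine Real.exp_le_exp.2 ?_
  have := nbrSpinSum_mono (zdGraph 2) 0 h
  nlinarith

/-- `e^{+2βS}` is nondecreasing for `β ≥ 0`. [cite: VanenterFernandezSokal1993, §4.1.2 Step 3] -/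
theorem unfixExpPos_mono {β : ℝ} (hβ : 0 ≤ β) : Monotone (unfixExpPos β) := fun σ σ' h => by
  unfold unfixExpPos
  refine Real.exp_le_exp.2 ?_
  have := nbrSpinSum_mono (zdGraph 2) 0 h
  nlinarith

/-- `e^{-2βS(-σ)} = e^{+2βS(σ)}` (the flip of (4.8)). [cite: VanenterFernandezSokal1993, §4.1.2 Step 3 eq. (4.8)] -/
theorem unfixExpNeg_neg (β : ℝ) (σ : SpinConfig (Site 2)) : unfixExpNeg β (-σ) = unfixExpPos β σ := by
  rw [unfixExpNeg, unfixExpPos, nbrSpinSum_neg]; ring_nf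

/-- `‖e^{cS}‖ ≤ e^{|c| deg 0}`. [cite: VanenterFernandezSokal1993, §4.1.2 Step 3 (bound on the denominator of (4.9))] -/
theorem norm_exp_mul_nbrSpinSum_le (c : ℝ) (σ : SpinConfig (Site 2)) :
    ‖Real.exp (c * nbrSpinSum (zdGraph 2) 0 σ)‖ ≤
      Real.exp (|c| * ((zdGraph 2).neighborFinset 0).card) := by
  rw [Real.norm_eq_abs, abs_of_pos (Real.exp_pos _)]
  refine Real.exp_le_exp.2 ?_
  calc c * nbrSpinSum (zdGraph 2) 0 σ ≤ |c * nbrSpinSum (zdGraph 2) 0 σ| := le_abs_self _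
    _ = |c| * |nbrSpinSum (zdGraph 2) 0 σ| := abs_mul _ _
    _ ≤ |c| * ((zdGraph 2).neighborFinset 0).card :=
        mul_le_mul_of_nonneg_left (abs_nbrSpinSum_le (zdGraph 2) 0 σ) (abs_nonneg c)

/-! ### From the phase-selecting patterns to admissible boundary conditions -/

/-- `2(n+1) = 2n+2` inside `box`. [cite: VanenterFernandezSokal1993, §4.1.2] -/
theorem box_two_mul_succ (n : ℕ) : box 2 (2 * (n + 1)) = box 2 (2 * n + 2) := by
  rw [show 2 * (n + 1) = 2 * n + 2 by ring]

/-- The phase-selecting sets pin the origin's image spin to `+ = ω'_alt(0)` (the hypothesis `ζ_a = 1`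
of the unfixing identity). [cite: VanenterFernandezSokal1993, §4.1.2 Step 3] -/
theorem apply_zero_of_eqOn_box {n : ℕ} {η : SpinConfig (Site 2)}
    (h : ∀ x ∈ box 2 n, decimate 2 2 η x = altConfig 2 x) : η 0 = 1 := by
  have := h 0 (zero_mem_box 2 n)
  rwa [decimate_apply_zero, altConfig_zero] at this

/-- **The `+` pattern gives an admissible boundary condition of sign `+`**: if `T₂η ∈ 𝒩_{n,n+1,+}`
then `η` has image spins `ω'_alt` on `Λ_{2n}` (the origin included, `+`) and `+1` on the annulus.
[cite: VanenterFernandezSokal1993, §4.1.2 Steps 2–3] -/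
theorem isAdmissibleBC_of_mem_plusSelected {n : ℕ} {η : SpinConfig (Site 2)}
    (h : decimate 2 2 η ∈ plusSelected 2 n (n + 1)) : IsAdmissibleBC n 1 η := by
  intro z hz hzi
  have hzx : double (halve z) = z := double_halve hzi
  constructor
  · intro hz2
    have hx : halve z ∈ box 2 n := (mem_box_two_mul_iff_halve hzi n).1 hz2
    have hv := h.1 _ hx
    rw [decimate_two_apply, hzx] at hv
    rw [one_mul, hv]
  · intro hz2
    have hx : halve z ∉ box 2 n := fun hx => hz2 ((mem_box_two_mul_iff_halve hzi n).2 hx)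
    have hx' : halve z ∈ box 2 (n + 1) := by
      rw [← mem_box_two_mul_iff_halve hzi (n + 1), box_two_mul_succ]; exact hz
    have hv := h.2 _ hx' hx
    rwa [decimate_two_apply, hzx] at hv

/-- **The `-` pattern, flipped, gives an admissible boundary condition of sign `-`**: if
`T₂η ∈ 𝒩_{n,n+1,-}` then `-η` has image spins `-ω'_alt` on `Λ_{2n}` (origin `-`) and `+1` on the
annulus (footnote 48). [cite: VanenterFernandezSokal1993, §4.1.2 Step 3 and footnote 48] -/
theorem isAdmissibleBC_neg_of_mem_minusSelected {n : ℕ} {η : SpinConfig (Site 2)}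
    (h : decimate 2 2 η ∈ minusSelected 2 n (n + 1)) : IsAdmissibleBC n (-1) (-η) := by
  intro z hz hzi
  have hzx : double (halve z) = z := double_halve hzi
  constructor
  · intro hz2
    have hx : halve z ∈ box 2 n := (mem_box_two_mul_iff_halve hzi n).1 hz2
    have hv := h.1 _ hx
    rw [decimate_two_apply, hzx] at hv
    rw [Pi.neg_apply, hv, neg_one_mul]
  · intro hz2
    have hx : halve z ∉ box 2 n := fun hx => hz2 ((mem_box_two_mul_iff_halve hzi n).2 hx)
    have hx' : halve z ∈ box 2 (n + 1) := by
      rw [← mem_box_two_mul_iff_halve hzi (n + 1), box_two_mul_succ]; exact hz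
    have hv := h.2 _ hx' hx
    rw [decimate_two_apply, hzx] at hv
    rw [Pi.neg_apply, hv, neg_neg]

/-! ### (4.12) in the reduced system: the product expansion of `e^{2βS} - e^{-2βS}` -/

/-- `e^{a σ_y} = cosh a + σ_y sinh a` sitewise, hence `e^{aS} = ∏_{y ∼ 0} (sinh a · σ_y + cosh a)`.
[cite: VanenterFernandezSokal1993, §4.1.2 Step 3 eq. (4.12)] -/
theorem exp_mul_nbrSpinSum_eq_prod (a : ℝ) (σ : SpinConfig (Site 2)) :
    Real.exp (a * nbrSpinSum (zdGraph 2) 0 σ) =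
      ∏ y ∈ (zdGraph 2).neighborFinset 0, (Real.sinh a * spinAt y σ + Real.cosh a) := by
  rw [nbrSpinSum, Finset.mul_sum, Real.exp_sum]
  refine Finset.prod_congr rfl fun y _ => ?_
  rw [exp_mul_eq_cosh_add_mul_sinh a (spinAt_eq_one_or_eq_neg_one y σ)]
  ring

/-- **The product expansion**: `e^{aS} = ∑_{A ⊆ N(0)} (sinh a)^{|A|} (cosh a)^{|N(0)∖A|} σ_A` (the
finite form of the series in (4.12)). [cite: VanenterFernandezSokal1993, §4.1.2 Step 3 eq. (4.12)] -/
theorem exp_mul_nbrSpinSum_eq_sum (a : ℝ) (σ : SpinConfig (Site 2)) :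
    Real.exp (a * nbrSpinSum (zdGraph 2) 0 σ) = ∑ A ∈ ((zdGraph 2).neighborFinset 0).powerset,
      (Real.sinh a) ^ A.card * (Real.cosh a) ^ (((zdGraph 2).neighborFinset 0) \ A).card *
        spinProduct A σ := by
  rw [exp_mul_nbrSpinSum_eq_prod, Finset.prod_add]
  refine Finset.sum_congr rfl fun A _ => ?_
  rw [Finset.prod_mul_distrib, Finset.prod_const, Finset.prod_const, spinProduct]
  ring

/-- **(4.12) in the reduced system, rigorously**: for `β ≥ 0`,
`⟨e^{2βS}⟩_{Q_n} - ⟨e^{-2βS}⟩_{Q_n} ≥ 2 sinh 2β · ⟨σ_{1,0}⟩_{Q_n}` — expand both exponentials,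
the even terms cancel, the odd ones are `2 (sinh 2β)^{|A|} (cosh 2β)^{4-|A|} ⟨σ_A⟩_{Q_n} ≥ 0` by
Griffiths' first inequality in the `+`-boundary system `Q_n` (`gks_one_holds (cutGraph n)`), and the
term `A = {(1,0)}` alone is `≥ 2 sinh 2β ⟨σ_{1,0}⟩` (`cosh ≥ 1`).
[cite: VanenterFernandezSokal1993, §4.1.2 Step 3 eqs. (4.9)–(4.12)] -/
theorem isingExpect_unfixExpPos_sub_unfixExpNeg_ge {n : ℕ} {β : ℝ} (hβ : 0 ≤ β) :
    2 * Real.sinh (2 * β) * isingExpect (cutGraph n) (internalVolume n) β 0 .plus (spinAt (vec 0)) ≤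
      isingExpect (cutGraph n) (internalVolume n) β 0 .plus (unfixExpPos β) -
        isingExpect (cutGraph n) (internalVolume n) β 0 .plus (unfixExpNeg β) := by
  set N := (zdGraph 2).neighborFinset 0 with hN
  set s := Real.sinh (2 * β) with hs
  set c := Real.cosh (2 * β) with hc
  have hs0 : 0 ≤ s := Real.sinh_nonneg_iff.2 (by linarith)
  have hc1 : 1 ≤ c := Real.one_le_cosh _
  -- coefficients of the expansion of `e^{2βS} - e^{-2βS}`
  set d : Finset (Site 2) → ℝ := fun A => (s ^ A.card - (-s) ^ A.card) * c ^ (N \ A).card with hd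
  have hd_nonneg : ∀ A, 0 ≤ d A := fun A => by
    refine mul_nonneg (sub_nonneg.2 ?_) (pow_nonneg (by linarith) _)
    calc (-s) ^ A.card ≤ |(-s) ^ A.card| := le_abs_self _
      _ = s ^ A.card := by rw [abs_pow, abs_neg, abs_of_nonneg hs0]
  have hexp : ∀ σ : SpinConfig (Site 2), unfixExpPos β σ - unfixExpNeg β σ =
      ∑ A ∈ N.powerset, d A * spinProduct A σ := by
    intro σ
    have hp : unfixExpPos β σ = Real.exp ((2 * β) * nbrSpinSum (zdGraph 2) 0 σ) := rfl
    have hm : unfixExpNeg β σ = Real.exp ((-(2 * β)) * nbrSpinSum (zdGraph 2) 0 σ) := by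
      rw [unfixExpNeg, neg_mul]
    rw [hp, hm, exp_mul_nbrSpinSum_eq_sum, exp_mul_nbrSpinSum_eq_sum, Real.sinh_neg,
      Real.cosh_neg, ← hs, ← hc, ← hN, ← Finset.sum_sub_distrib]
    refine Finset.sum_congr rfl fun A _ => ?_
    simp only [hd]
    ring
  -- linearity and Griffiths I in the reduced (`+`-boundary) system
  have hmeas : ∀ A : Finset (Site 2), Measurable fun σ : SpinConfig (Site 2) => d A * spinProduct A σ :=
    fun A => (measurable_spinProduct A).const_mul _
  have hlin : isingExpect (cutGraph n) (internalVolume n) β 0 .plus (unfixExpPos β) -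
      isingExpect (cutGraph n) (internalVolume n) β 0 .plus (unfixExpNeg β) =
      ∑ A ∈ N.powerset, d A * isingExpect (cutGraph n) (internalVolume n) β 0 .plus (spinProduct A) := by
    have hsub : isingExpect (cutGraph n) (internalVolume n) β 0 .plus (unfixExpPos β) -
        isingExpect (cutGraph n) (internalVolume n) β 0 .plus (unfixExpNeg β) =
        isingExpect (cutGraph n) (internalVolume n) β 0 .plus (fun σ => unfixExpPos β σ - unfixExpNeg β σ) := by
      have := isingExpect_add' (cutGraph n) (internalVolume n) 0 .plus β
        (f := fun σ => unfixExpPos β σ - unfixExpNeg β σ) (g := unfixExpNeg β)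
        ((measurable_unfixExpPos β).sub (measurable_unfixExpNeg β)) (measurable_unfixExpNeg β)
      simp only [sub_add_cancel] at this
      linarith
    rw [hsub, show (fun σ => unfixExpPos β σ - unfixExpNeg β σ) = fun σ => ∑ A ∈ N.powerset, d A * spinProduct A σ
      from funext hexp, isingExpect_finset_sum' (cutGraph n) (internalVolume n) 0 .plus β _ _ hmeas]
    refine Finset.sum_congr rfl fun A _ => ?_
    exact isingExpect_const_mul' (cutGraph n) (internalVolume n) 0 .plus β (d A) (measurable_spinProduct A)
  have hgks : ∀ A ∈ N.powerset, 0 ≤ isingExpect (cutGraph n) (internalVolume n) β 0 .plus (spinProduct A) := by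
    intro A hA
    have hAW : A ⊆ internalVolume n :=
      (Finset.mem_powerset.1 hA).trans (neighborFinset_zero_subset_internalVolume n)
    exact GKSInequalities.gks_one_holds (cutGraph n) hβ le_rfl (Or.inr rfl) hAW
  rw [hlin]
  -- keep the term `A = {e₀}`
  have hmem : ({vec 0} : Finset (Site 2)) ∈ N.powerset := by
    rw [Finset.mem_powerset, Finset.singleton_subset_iff]
    exact vec_mem_neighborFinset_zero 0
  have hterm : 2 * s * isingExpect (cutGraph n) (internalVolume n) β 0 .plus (spinAt (vec 0)) ≤
      d {vec 0} * isingExpect (cutGraph n) (internalVolume n) β 0 .plus (spinProduct {vec 0}) := by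
    have hsp : spinProduct ({vec 0} : Finset (Site 2)) = spinAt (vec 0) := by
      funext σ; simp [spinProduct]
    rw [hsp]
    have hE : 0 ≤ isingExpect (cutGraph n) (internalVolume n) β 0 .plus (spinAt (vec 0)) := by
      rw [← hsp]; exact hgks _ hmem
    refine mul_le_mul_of_nonneg_right ?_ hE
    simp only [hd, Finset.card_singleton, pow_one, sub_neg_eq_add]
    have : 1 ≤ c ^ (N \ {vec 0}).card := one_le_pow₀ hc1
    nlinarith
  exact hterm.trans (Finset.single_le_sum (f := fun A => d A *
    isingExpect (cutGraph n) (internalVolume n) β 0 .plus (spinProduct A))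
    (fun A hA => mul_nonneg (hd_nonneg A) (hgks A hA)) hmem)

/-! ### The bounds on the two patterns -/

/-- `t ↦ (1 - t)/(1 + t)` is nonincreasing on `t > -1`. [cite: VanenterFernandezSokal1993, §4.1.2 Step 3 eq. (4.9)] -/
theorem one_sub_div_one_add_antitone {a b : ℝ} (ha : -1 < a) (hab : a ≤ b) :
    (1 - b) / (1 + b) ≤ (1 - a) / (1 + a) := by
  have hb : 0 < 1 + b := by linarith
  have ha' : 0 < 1 + a := by linarith
  rw [div_le_div_iff₀ hb ha']
  nlinarith

/-- **The `+` pattern: `⟨σ_0⟩^η_{W_n} ≥ c₊ = (1 - x_Q)/(1 + x_Q)`**, `x_Q = ⟨e^{-2βS}⟩_{Q_n}`: by the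
unfixing identity (4.7) `⟨σ_0⟩ = (1-x)/(1+x)` with `x = ⟨e^{-2βS}⟩^{η}_{W'_n}` (the origin frozen to
`η_0 = +`), and `x ≤ x_Q` by the FKG comparison with the reduced system (`e^{-2βS}` is
nonincreasing; `η` is admissible of sign `+`).
[cite: VanenterFernandezSokal1993, §4.1.2 Step 3 eqs. (4.7), (4.10) and Step 2] -/
theorem isingExpect_spinAt_zero_ge_of_plusSelected {n : ℕ} {β : ℝ} (hβ : 0 ≤ β)
    {η : SpinConfig (Site 2)} (h : decimate 2 2 η ∈ plusSelected 2 n (n + 1)) :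
    (1 - isingExpect (cutGraph n) (internalVolume n) β 0 .plus (unfixExpNeg β)) /
        (1 + isingExpect (cutGraph n) (internalVolume n) β 0 .plus (unfixExpNeg β)) ≤
      isingExpect (zdGraph 2) (israelVolume n) β 0 (.fixed η) (spinAt 0) := by
  rw [isingExpect_spinAt_eq_unfix (zdGraph 2) (zero_mem_israelVolume n)
    (mem_israelVolume_erase_of_adj_zero n) β (apply_zero_of_eqOn_box h.1), israelVolume_erase_zero]
  change (1 - _) / (1 + _) ≤ (1 - isingExpect (zdGraph 2) (internalVolume n) β 0 (.fixed η) (unfixExpNeg β)) /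
    (1 + isingExpect (zdGraph 2) (internalVolume n) β 0 (.fixed η) (unfixExpNeg β))
  refine one_sub_div_one_add_antitone ?_ ?_
  · have := isingExpect_pos (zdGraph 2) (internalVolume n) β 0 (.fixed η) (measurable_unfixExpNeg β)
      (fun σ => Real.exp_pos _)
    linarith
  · exact isingExpect_admissible_le_cut hβ (isAdmissibleBC_of_mem_plusSelected h)
      (unfixExpNeg_antitone hβ) (measurable_unfixExpNeg β) (fun σ σ' hσ => by
        unfold unfixExpNeg; rw [nbrSpinSum_zero_congr (d := 2) (R' := n + 1) (by omega) hσ])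

/-- **The `-` pattern: `⟨σ_0⟩^η_{W_n} ≤ c₋ = (1 - y_Q)/(1 + y_Q)`**, `y_Q = ⟨e^{+2βS}⟩_{Q_n}`: by (4.7),
`⟨σ_0⟩ = (1-x)/(1+x)` with `x = ⟨e^{-2βS}⟩^{η}_{W'_n} = ⟨e^{+2βS}⟩^{-η}_{W'_n}` (spin flip, (4.8)), and
`x ≥ y_Q` by the FKG comparison (`e^{+2βS}` is nondecreasing; `-η` is admissible of sign `-`,
footnote 48). [cite: VanenterFernandezSokal1993, §4.1.2 Step 3 eqs. (4.7)–(4.8), (4.11) and footnote 48] -/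
theorem isingExpect_spinAt_zero_le_of_minusSelected {n : ℕ} {β : ℝ} (hβ : 0 ≤ β)
    {η : SpinConfig (Site 2)} (h : decimate 2 2 η ∈ minusSelected 2 n (n + 1)) :
    isingExpect (zdGraph 2) (israelVolume n) β 0 (.fixed η) (spinAt 0) ≤
      (1 - isingExpect (cutGraph n) (internalVolume n) β 0 .plus (unfixExpPos β)) /
        (1 + isingExpect (cutGraph n) (internalVolume n) β 0 .plus (unfixExpPos β)) := by
  rw [isingExpect_spinAt_eq_unfix (zdGraph 2) (zero_mem_israelVolume n)
    (mem_israelVolume_erase_of_adj_zero n) β (apply_zero_of_eqOn_box h.1), israelVolume_erase_zero]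
  change (1 - isingExpect (zdGraph 2) (internalVolume n) β 0 (.fixed η) (unfixExpNeg β)) /
    (1 + isingExpect (zdGraph 2) (internalVolume n) β 0 (.fixed η) (unfixExpNeg β)) ≤ (1 - _) / (1 + _)
  -- the spin flip (4.8)
  have hflip : isingExpect (zdGraph 2) (internalVolume n) β 0 (.fixed η) (unfixExpNeg β) =
      isingExpect (zdGraph 2) (internalVolume n) β 0 (.fixed (-η)) (unfixExpPos β) := by
    have := isingExpect_fixed_neg (zdGraph 2) (internalVolume n) β 0 (-η) (measurable_unfixExpNeg β)
    rw [neg_zero, neg_neg] at this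
    rw [this]
    exact congrArg _ (funext fun σ => unfixExpNeg_neg β σ)
  rw [hflip]
  refine one_sub_div_one_add_antitone ?_ ?_
  · have := isingExpect_pos (cutGraph n) (internalVolume n) β 0 .plus (measurable_unfixExpPos β)
      (fun σ => Real.exp_pos _)
    linarith
  · exact isingExpect_cut_le_admissible hβ (isAdmissibleBC_neg_of_mem_minusSelected h)
      (unfixExpPos_mono hβ) (measurable_unfixExpPos β) (fun σ σ' hσ => by
        unfold unfixExpPos; rw [nbrSpinSum_zero_congr (d := 2) (R' := n + 1) (by omega) hσ])

/-! ### Assembly: (4.13) from Step 2 -/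

/-- The coupling of Theorem 4.1 is positive: `½ cosh⁻¹(1+√2) > β_c(2) > 0`.
[cite: VanenterFernandezSokal1993, Theorem 4.1] -/
theorem israelThreshold_pos : 0 < israelThreshold :=
  criticalBetaTwo_pos.trans criticalBetaTwo_lt_israelThreshold

/-- **van Enter–Fernández–Sokal (4.13) from Step 2**: the finite-volume estimate
`VEFS1993_eq413_israel` (levels `c₊ = (1-x_Q)/(1+x_Q)`, `c₋ = (1-y_Q)/(1+y_Q)` per `n`, gap
`c₊ - c₋ = 2(y_Q - x_Q)/((1+x_Q)(1+y_Q)) ≥ 2·(2 sinh 2β · m)/(1+B)² = δ`, `B = e^{2β deg 0}`,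
(4.9)–(4.13) via `unfix_gap_bound`) follows from the positive magnetisation `⟨σ_{1,0}⟩_{Q_n} ≥ m` of
the reduced system for `n ≥ n₀` (Step 2, `VEFS1993_eq46_reduced`).
[cite: VanenterFernandezSokal1993, §4.1.2 Step 3 eqs. (4.9)–(4.13)] -/
theorem VEFS1993_eq413_israel_of_eq46 (h46 : VEFS1993_eq46_reduced) : VEFS1993_eq413_israel := by
  intro β hβ
  have hβ0 : 0 ≤ β := (israelThreshold_pos.trans hβ).le
  have hβpos : 0 < β := israelThreshold_pos.trans hβ
  obtain ⟨m, hm, n₀, hn⟩ := h46 β hβ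
  set s := Real.sinh (2 * β) with hs
  set B := Real.exp (|2 * β| * ((zdGraph 2).neighborFinset 0).card) with hB
  have hs0 : 0 < s := Real.sinh_pos_iff.2 (by linarith)
  refine ⟨2 * (2 * s * m) / (1 + B) ^ 2, by positivity, n₀, fun n hn' => ?_⟩
  set xQ := isingExpect (cutGraph n) (internalVolume n) β 0 .plus (unfixExpNeg β) with hxQ
  set yQ := isingExpect (cutGraph n) (internalVolume n) β 0 .plus (unfixExpPos β) with hyQ
  have hx0 : 0 < xQ := isingExpect_pos (cutGraph n) (internalVolume n) β 0 .plus
    (measurable_unfixExpNeg β) (fun σ => Real.exp_pos _)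
  have hy0 : 0 < yQ := isingExpect_pos (cutGraph n) (internalVolume n) β 0 .plus
    (measurable_unfixExpPos β) (fun σ => Real.exp_pos _)
  have hxB : xQ ≤ B := by
    have hb : ∀ σ, ‖unfixExpNeg β σ‖ ≤ B := fun σ => by
      have := norm_exp_mul_nbrSpinSum_le (-(2 * β)) σ
      rw [abs_neg] at this
      simpa only [unfixExpNeg, neg_mul] using this
    exact (le_abs_self _).trans ((Real.norm_eq_abs _).symm.le.trans
      (norm_isingExpect_le (cutGraph n) (internalVolume n) β 0 .plus hb))
  have hyB : yQ ≤ B := by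
    have hb : ∀ σ, ‖unfixExpPos β σ‖ ≤ B := fun σ => norm_exp_mul_nbrSpinSum_le (2 * β) σ
    exact (le_abs_self _).trans ((Real.norm_eq_abs _).symm.le.trans
      (norm_isingExpect_le (cutGraph n) (internalVolume n) β 0 .plus hb))
  have hgap : 2 * s * m ≤ yQ - xQ :=
    le_trans (mul_le_mul_of_nonneg_left (hn n hn') (by positivity))
      (isingExpect_unfixExpPos_sub_unfixExpNeg_ge hβ0)
  exact ⟨(1 - xQ) / (1 + xQ), (1 - yQ) / (1 + yQ),
    unfix_gap_bound hx0 hxB hy0 hyB (by positivity) hgap,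
    fun η hη => isingExpect_spinAt_zero_ge_of_plusSelected hβ0 hη,
    fun η hη => isingExpect_spinAt_zero_le_of_minusSelected hβ0 hη⟩

/-- **Theorem 4.1 from Step 2 for the reduced system** (the assembly so far): Step 2
(`VEFS1993_eq46_reduced`, named fact) ⟹ (4.13) (`VEFS1993_eq413_israel_of_eq46`, proved) ⟹
Theorem 4.1 (`VEFS1993_thm41_of_eq413_israel`, proved).
[cite: VanenterFernandezSokal1993, Theorem 4.1] -/
theorem VEFS1993_thm41_of_eq46 (h46 : VEFS1993_eq46_reduced) : VEFS1993_thm41 :=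
  VEFS1993_thm41_of_eq413_israel (VEFS1993_eq413_israel_of_eq46 h46)

end Literature.Barriers.CriticalPhenomena.NonGibbs

end
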